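import Mathlib
import HarnessLib
import Literature.Analysis.FluidPDE.HydrodynamicImpulse
import Summits.NavierStokesRegularity.FluidComputer.PalasekTowerStageSmoothness
import Literature.Analysis.FluidPDE.TotalVorticityFlux
import Summits.NavierStokesRegularity.NavierStokesRegularity.Theorems.HeredityAtOne.Negative.CapStratum
import Summits.NavierStokesRegularity.NavierStokesRegularity.Theorems.HeredityAtOne.Negative.LazyEnvelopeSliceSigned

/-!
# The capped signed swirl-free stratum contains NO stage with an integrable readout slice
# (hydrodynamic impulse: `CapStratumEmptyAt k` holds on the integrable sub-register, design-free)

Cell `ns-blowup`, seat `ns-blowup-fc-prover-3` (g7; prover, GROUP E re-point; bears_on LADDER-NS N1, route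
`PalasekTowerBreakdown`, crux `HeredityAtOne` = item stmt-NavierStokesRegularity-19249, NEGATIVE LANE — supports
only). LABEL: KERNEL bookkeeping (theorems only; no definition, no named fact, nothing asserted about the crux).

THE POINT. disprove-1's lossless split of the item (`CapStratum.lean`, p481383):
`HeredityAtOne ↔ HeredityAtOffStratum 1 ∧ CapStratumEmptyAt 1`, where the stratum `𝒮_k` (`InCapStratum k S s`)
consists of the registered level-`k` stages whose `τ_k`-slice is a single-signed swirl-free axisymmetric field
(`SignedNoSwirlSlice`, `ω_θ/r ≥ 0`) with Gallay–Šverák cap value below the next floor; `CapStratum.lean` records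
that the emptiness conjunct is «presently certifiable only in the vacuous regime `¬ EpisodeBaseG`». This file
certifies it NON-VACUOUSLY ON A SUB-REGISTER, by kinematics alone: a single-signed swirl-free slice carries the
positive HYDRODYNAMIC IMPULSE `I₃ = ½ ∫ r² (ω_θ/r) dx` (Saffman, *Vortex Dynamics* §3.2 (8)), whereas every
INTEGRABLE divergence-free `C¹` field has zero velocity flux and zero impulse (Saffman (3.2.11)/(3.2.13)/(3.2.15)
for integrable fields = the tree's `Literature/Analysis/FluidPDE/HydrodynamicImpulse.lean`, this seat). Hence:

* `signedNoSwirlSlice_eq_zero_of_integrable` — a `C³` divergence-free signed swirl-free slice that is integrable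
  and square integrable is IDENTICALLY ZERO (`ω_θ ≡ 0` by the impulse, `curl v = 0`, Biot–Savart representation);
* `not_integrable_of_signedNoSwirlSlice` — for EVERY registered stage (any rates, schedule, margins,
  viscosity, level `k`) and every readout level `j ≤ k`: if the `τ_j`-slice is signed swirl-free then it is NOT
  integrable (the stage's own floor `c₁ Y_j ≤ ‖u(τ_j, x_j)‖` forbids the zero slice);
* `not_inCapStratum_of_integrable`, `capStratumEmptyAt_on_integrable` — **no registered stage with an integrable
  `τ_k`-slice lies in `𝒮_k`**: the emptiness conjunct `CapStratumEmptyAt k` HOLDS on the integrable sub-register,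
  for every `k`, with no design hypothesis (pins / rigidity / quietness are not even used);
* `heredityAtOffStratum_one_covers_integrable` — by name: the REPAIRED statement `C′ = HeredityAtOffStratum 1`
  already decides every registered level-1 stage whose `τ₁`-slice is integrable; the residual emptiness conjunct
  of item 19249 concerns impulse-carrying (non-integrable, `|x|⁻³`-tailed) slices only;
* `not_integrable_lazySlice` — sanity: the lazy envelope slice of p484570 (smoothed Hill vortex, `ω_θ/r = M` on
  its core) is not integrable, as its dipole tail says.

IMPULSE LEDGER (reading for the design seats; the dynamics is NOT typed here). Saffman (3.2.9): along a smooth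
decaying Navier–Stokes flow `dI/dt = ∫ f dx` — the impulse is conserved without force and CHANGED ONLY BY THE
SPATIAL MEAN OF THE FORCE; viscosity does not act on it. A Clay datum (`S.u₀`, rapidly decaying, divergence free)
has `I(0) = ∫ u₀ = 0` (`integral_eq_zero_of_isDivFree_of_integrable`). Consequently a registered slice can be
single-signed swirl-free only if the design's force has injected axial impulse `∫₀^{τ_k} ∫ f₃ dx dt =
½ ∫ r²(ω_θ/r)(τ_k) > 0` — mean-zero pushes (in particular `curl`-type forces `f = curl A` with decaying `A`, e.g.
the cell's `curl demoPot` hosts) can never populate the stratum, while a force of non-zero mean gives the slice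
the `O(|I|/r³)` dipole tail (Saffman (3.2.7)) and takes it OUT of the integrable sub-register treated here. The
two untyped inputs that would turn this reading into a theorem «`CapStratumEmptyAt k` on all mean-zero-forced
designs» are (i) the impulse balance (3.2.9) for Clay-class forced solutions and (ii) spatial decay
`u(τ_k) = O(|x|⁻⁴)` for zero-impulse slices (Brandolese–Meyer 2002 / Miyakawa 2000 / Brandolese 2004 §1). This
CORRECTS the lineage's g6 note (HANDOFF § fc-prover-3 g6 (ii): «registered slices are L¹, hence never
single-signed»): true for mean-zero forcing only.

WHAT THIS IS NOT: not Navier–Stokes evidence and no verdict change on item 19249 — kinematics of integrable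
vector fields applied to the register's readout slices; no stage, slice, flow or design is constructed; the
stratum's emptiness OFF the integrable sub-register (impulse-carrying designs) is untouched and remains
`EpisodeBaseG|𝒮`-hard.

References: P. G. Saffman, *Vortex Dynamics* (1992) §3.2 (3.2.7)–(3.2.15) [cite: Saffman1992, §3.2];
Th. Gallay, V. Šverák, Confluentes Math. 7 (2015) [cite: GallaySverak2016, Prop. 2.6 (2.14)]; A. J. Majda,
A. L. Bertozzi (2002) Prop. 2.16 [cite: MajdaBertozziCUP2002, §2.4.1 Prop. 2.16]; S. Palasek, arXiv:2605.13827 §4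
[cite: Palasek2026ElementaryModel, §4]; L. Brandolese, Math. Ann. 329 (2004) §1 [cite: Brandolese2004, §1].
-/

noncomputable section

namespace Summit.NavierStokesRegularity.HeredityAtOneImpulse

open Set MeasureTheory
open Literature.Analysis.FluidPDE
open Summit.NavierStokesRegularity.FluidComputer
open Summit.NavierStokesRegularity.FluidComputer.PalasekTowerClayBridge
open Summit.NavierStokesRegularity.NavierStokesRegularity
open Summit.NavierStokesRegularity.HeredityAtOneNoSwirlCap
open Summit.NavierStokesRegularity.HeredityAtOneNoSwirlStratum

/-! ## §1 A signed swirl-free slice that is integrable (and finite-energy) is zero -/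

/-- **An integrable, finite-energy, divergence-free signed swirl-free slice is identically zero.** For
`v ∈ C³(ℝ³; ℝ³)` divergence free with `SignedNoSwirlSlice v M` (axisymmetric, no swirl, `0 ≤ ω_θ/r ≤ M`,
`ω_θ/r` and `r²·ω_θ/r` integrable), `v ∈ L¹` and `‖v‖² ∈ L¹` force `v = 0`: the axial impulse
`½∫r²(ω_θ/r)` of an integrable divergence-free field vanishes (Saffman (3.2.13)/(3.2.15)), so `ω_θ/r ≡ 0`,
`curl v = 0`, and `v` is the Biot–Savart velocity of `0`. [cite: Saffman1992, §3.2 eqs. (3.2.8), (3.2.13)] -/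
theorem signedNoSwirlSlice_eq_zero_of_integrable {v : EuclideanSpace ℝ (Fin 3) → EuclideanSpace ℝ (Fin 3)}
    {M : ℝ} (hsl : SignedNoSwirlSlice v M) (hv : ContDiff ℝ 3 v) (hdiv : VectorCalculus.IsDivFree v)
    (hint : Integrable v) (h2 : Integrable fun y => ‖v y‖ ^ 2) : v = 0 :=
  hsl.axisym.eq_zero_of_nonneg_of_integrable hsl.noSwirl hv hdiv hint h2 hsl.integrable_sq hsl.nonneg

/-- **`ω_θ/r ≡ 0` for an integrable divergence-free signed swirl-free slice** (no energy hypothesis): the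
impulse density `r²·(ω_θ/r) ≥ 0` of an integrable divergence-free `C³` field integrates to zero.
[cite: Saffman1992, §3.2 eqs. (3.2.8), (3.2.13)] -/
theorem angVortQuot_eq_zero_of_signedNoSwirlSlice_of_integrable
    {v : EuclideanSpace ℝ (Fin 3) → EuclideanSpace ℝ (Fin 3)} {M : ℝ} (hsl : SignedNoSwirlSlice v M)
    (hv : ContDiff ℝ 3 v) (hdiv : VectorCalculus.IsDivFree v) (hint : Integrable v)
    (x : EuclideanSpace ℝ (Fin 3)) : angVortQuot v x = 0 :=
  hsl.axisym.angVortQuot_eq_zero_of_nonneg_of_integrable hv hdiv hint hsl.integrable_sq hsl.nonneg x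

/-! ## §2 Registered readout slices: signed swirl-free ⇒ not integrable -/

section Register

variable {ν : ℝ} {R : TowerRates} {S : Schedule R} {m : Margins R} {k : ℕ}

/-- The readout time `τ_j`, `j ≤ k`, lies in the slab `[0, τ_k]` of a level-`k` stage. [folklore] -/
theorem τ_mem_Icc (S : Schedule R) {j k : ℕ} (hj : j ≤ k) : S.τ j ∈ Icc 0 (S.τ k) :=
  ⟨(S.τ_pos j).le, S.τ_mono hj⟩

/-- Every slice of a registered stage is square integrable (the stage's energy clause, continuity of the
slice). [folklore] -/
theorem integrable_norm_sq_slice (s : Stage ν R S m k) {t : ℝ} (ht : t ∈ Icc 0 (S.τ k)) :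
    Integrable fun y => ‖s.u t y‖ ^ 2 := by
  obtain ⟨C, hCt, hC⟩ := s.energy
  exact integrable_sq_norm_of_lintegral_lt_top (s.contDiff_slice ht).continuous ((hC t ht).trans_lt hCt)

/-- The readout slice of a registered stage is never the zero field: the floor `c₁ Y_j ≤ ‖u(τ_j, x_j)‖` with
`c₁ > 0`, `Y_j > 0`. [cite: Palasek2026ElementaryModel, §3.3] -/
theorem slice_ne_zero (s : Stage ν R S m k) {j : ℕ} (hj : j ≤ k) : s.u (S.τ j) ≠ 0 := by
  intro h0
  obtain ⟨x, -, hx⟩ := s.floor j hj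
  have hY : 0 < R.Y j := Real.rpow_pos_of_pos (R.N_pos j) _
  have hpos : 0 < S.c₁ * R.Y j := mul_pos S.c₁_pos hY
  rw [h0] at hx
  simp at hx
  linarith

/-- **A SIGNED SWIRL-FREE READOUT SLICE OF A REGISTERED STAGE IS NOT INTEGRABLE** (any rates, schedule, margins,
viscosity, level `k`, readout level `j ≤ k`): the slice is `C^∞`, divergence free and finite-energy, so if it were
integrable it would vanish (`signedNoSwirlSlice_eq_zero_of_integrable`), contradicting the registered floor at
`τ_j`. Equivalently: such a slice carries non-zero hydrodynamic impulse and an `|x|⁻³` tail.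
[cite: Saffman1992, §3.2 eqs. (3.2.8), (3.2.13)] [cite: Palasek2026ElementaryModel, §3.3] -/
theorem not_integrable_of_signedNoSwirlSlice (s : Stage ν R S m k) {j : ℕ} (hj : j ≤ k) {M : ℝ}
    (hsl : SignedNoSwirlSlice (s.u (S.τ j)) M) : ¬ Integrable (s.u (S.τ j)) := by
  intro hint
  have ht : S.τ j ∈ Icc 0 (S.τ k) := τ_mem_Icc S hj
  have hv : ContDiff ℝ 3 (s.u (S.τ j)) :=
    (s.contDiff_slice ht).of_le (by norm_cast)
  exact slice_ne_zero s hj (signedNoSwirlSlice_eq_zero_of_integrable hsl hv (s.classical.divFree _ ht) hint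
    (integrable_norm_sq_slice s ht))

/-- The same with the integrability as the hypothesis: an integrable readout slice of a registered stage is
not a signed swirl-free slice (for any height `M`). [cite: Saffman1992, §3.2 eqs. (3.2.8), (3.2.13)] -/
theorem not_signedNoSwirlSlice_of_integrable (s : Stage ν R S m k) {j : ℕ} (hj : j ≤ k)
    (hint : Integrable (s.u (S.τ j))) (M : ℝ) : ¬ SignedNoSwirlSlice (s.u (S.τ j)) M :=
  fun hsl => not_integrable_of_signedNoSwirlSlice s hj hsl hint

end Register

/-! ## §3 The stratum `𝒮_k` of item 19249's split, on the integrable sub-register -/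

/-- **NO REGISTERED STAGE WITH AN INTEGRABLE `τ_k`-SLICE LIES IN THE CAPPED SIGNED SWIRL-FREE STRATUM `𝒮_k`**
(wide rates, route margins, unit viscosity — the binder of `InCapStratum`; no pins / rigidity / quietness used,
no cap inequality used). [cite: Saffman1992, §3.2 eqs. (3.2.8), (3.2.13)] [cite: Palasek2026ElementaryModel, §4] -/
theorem not_inCapStratum_of_integrable {k : ℕ} {S : Schedule TowerRates.wide}
    (s : Stage 1 TowerRates.wide S (Margins.routeG TowerRates.wide) k) (hint : Integrable (s.u (S.τ k))) :
    ¬ InCapStratum k S s :=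
  fun ⟨_, hsl, _⟩ => not_integrable_of_signedNoSwirlSlice s le_rfl hsl hint

/-- **Members of the stratum carry impulse**: the `τ_k`-slice of a stage in `𝒮_k` is NOT integrable.
[cite: Saffman1992, §3.2 eqs. (3.2.8), (3.2.13)] -/
theorem not_integrable_of_inCapStratum {k : ℕ} {S : Schedule TowerRates.wide}
    {s : Stage 1 TowerRates.wide S (Margins.routeG TowerRates.wide) k} (hs : InCapStratum k S s) :
    ¬ Integrable (s.u (S.τ k)) :=
  fun hint => not_inCapStratum_of_integrable s hint hs

/-- **`CapStratumEmptyAt k` ON THE INTEGRABLE SUB-REGISTER** — the emptiness conjunct of item 19249's lossless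
split, restricted to registered stages whose `τ_k`-slice is integrable, HOLDS for every `k`, design-free and
non-vacuously (the binder shape of `CapStratumEmptyAt` with one extra guard). What remains open of
`CapStratumEmptyAt 1` concerns impulse-carrying slices only (designs whose force has non-zero mean).
[cite: Saffman1992, §3.2 eqs. (3.2.8), (3.2.9), (3.2.13)] [cite: Palasek2026ElementaryModel, §4] -/
theorem capStratumEmptyAt_on_integrable (k : ℕ) :
    ∀ S : Schedule TowerRates.wide, S.Pins 8 (6 / 5) → S.Rigid → S.Quiet →
      ∀ s : Stage 1 TowerRates.wide S (Margins.routeG TowerRates.wide) k,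
        Integrable (s.u (S.τ k)) → ¬ InCapStratum k S s :=
  fun _ _ _ _ s hint => not_inCapStratum_of_integrable s hint

/-- **By name: the repaired statement `C′ = HeredityAtOffStratum 1` already decides every registered level-1
stage with an integrable `τ₁`-slice** — such a stage is off the stratum, so `C′` hands it a level-2 extension.
[cite: Palasek2026ElementaryModel, §4] -/
theorem heredityAtOffStratum_one_covers_integrable (h : HeredityAtOffStratum 1) {S : Schedule TowerRates.wide}
    (hP : S.Pins 8 (6 / 5)) (hR : S.Rigid) (hQ : S.Quiet)
    (s : Stage 1 TowerRates.wide S (Margins.routeG TowerRates.wide) 1) (hint : Integrable (s.u (S.τ 1))) :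
    ∃ s' : Stage 1 TowerRates.wide S (Margins.routeG TowerRates.wide) 2, s.Extends s' :=
  h S hP hR hQ s (not_inCapStratum_of_integrable s hint)

/-- **By name, for the crux**: item 19249 restricted to registered level-1 stages with an INTEGRABLE `τ₁`-slice
is implied by the repaired statement `HeredityAtOffStratum 1` alone — the emptiness conjunct is discharged
there. (The full item is `HeredityAtOffStratum 1 ∧ CapStratumEmptyAt 1`, `heredityAtOne_iff_offStratum_and_empty`.)
[cite: Palasek2026ElementaryModel, §4] -/
theorem heredityAtOne_on_integrable_of_offStratum (h : HeredityAtOffStratum 1) :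
    ∀ S : Schedule TowerRates.wide, S.Pins 8 (6 / 5) → S.Rigid → S.Quiet →
      ∀ s : Stage 1 TowerRates.wide S (Margins.routeG TowerRates.wide) 1, Integrable (s.u (S.τ 1)) →
        ∃ s' : Stage 1 TowerRates.wide S (Margins.routeG TowerRates.wide) 2, s.Extends s' :=
  fun _ hP hR hQ s hint => heredityAtOffStratum_one_covers_integrable h hP hR hQ s hint


/-- **THE SPLIT OF ITEM 19249, SHARPENED BY NAME**: the emptiness conjunct of
`heredityAtOne_iff_offStratum_and_empty` may be restricted to registered level-1 stages whose `τ₁`-slice is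
NOT integrable (impulse-carrying slices) — the integrable ones are off the stratum by kinematics.
`HeredityAtOne ↔ HeredityAtOffStratum 1 ∧ (𝒮₁ contains no stage with a non-integrable … i.e. every member of 𝒮₁
has a non-integrable slice, and there is none)`. [cite: Saffman1992, §3.2 eqs. (3.2.8), (3.2.13)]
[cite: Palasek2026ElementaryModel, §4] -/
theorem heredityAtOne_iff_offStratum_and_empty_nonIntegrable :
    Theses.PalasekTowerBreakdown.HeredityAtOne ↔
      HeredityAtOffStratum 1 ∧
        ∀ S : Schedule TowerRates.wide, S.Pins 8 (6 / 5) → S.Rigid → S.Quiet →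
          ∀ s : Stage 1 TowerRates.wide S (Margins.routeG TowerRates.wide) 1,
            ¬ Integrable (s.u (S.τ 1)) → ¬ InCapStratum 1 S s := by
  rw [heredityAtOne_iff_offStratum_and_empty]
  refine ⟨fun h => ⟨h.1, fun S hP hR hQ s _ => h.2 S hP hR hQ s⟩, fun h => ⟨h.1, fun S hP hR hQ s => ?_⟩⟩
  by_cases hint : Integrable (s.u (S.τ 1))
  · exact not_inCapStratum_of_integrable s hint
  · exact h.2 S hP hR hQ s hint

/-- **Hence a refutation of item 19249 through the stratum needs an impulse-carrying design**: if the repaired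
statement `C′ = HeredityAtOffStratum 1` holds, any counterexample to `HeredityAtOne` is a pinned rigid quiet wide
design with a registered level-1 stage IN `𝒮₁` whose `τ₁`-slice is NOT integrable (non-zero hydrodynamic
impulse, `|x|⁻³` tail — by Saffman (3.2.9) the design's force must have non-zero spatial mean).
[cite: Saffman1992, §3.2 eqs. (3.2.8), (3.2.9), (3.2.13)] [cite: Palasek2026ElementaryModel, §4] -/
theorem exists_nonIntegrable_stratum_stage_of_not_heredityAtOne (hC : HeredityAtOffStratum 1)
    (h : ¬ Theses.PalasekTowerBreakdown.HeredityAtOne) :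
    ∃ (S : Schedule TowerRates.wide) (s : Stage 1 TowerRates.wide S (Margins.routeG TowerRates.wide) 1),
      S.Pins 8 (6 / 5) ∧ S.Rigid ∧ S.Quiet ∧ InCapStratum 1 S s ∧ ¬ Integrable (s.u (S.τ 1)) := by
  by_contra hne
  push Not at hne
  refine h (heredityAtOne_iff_offStratum_and_empty_nonIntegrable.2 ⟨hC, fun S hP hR hQ s hni hs => ?_⟩)
  exact hni (hne S s hP hR hQ hs)

/-! ## §4 Sanity: the lazy envelope slice (p484570) is not integrable -/

/-- **The lazy envelope slice is not integrable** (it is a smoothed Hill vortex: `ω_θ/r = 3.92·10⁸ > 0` on its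
core, so `ω_θ/r ≢ 0`, while an integrable divergence-free signed swirl-free `C³` field has `ω_θ/r ≡ 0`). Its far
field is the exact dipole of p480439/p482319 — the `O(|I|/r³)` tail of Saffman (3.2.7).
[cite: Saffman1992, §3.2 eqs. (3.2.7)–(3.2.8)] -/
theorem not_integrable_lazySlice : ¬ Integrable HeredityAtOneLazySlice.lazySlice := by
  intro hint
  have hsl := HeredityAtOneLazySlice.signedNoSwirlSlice_lazySlice
  have hv : ContDiff ℝ 3 HeredityAtOneLazySlice.lazySlice := SmoothedHill.contDiff_hillField _ _ _
  have h0 := angVortQuot_eq_zero_of_signedNoSwirlSlice_of_integrable hsl hv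
    (SmoothedHill.isDivFree_hillField _ _ _) hint 0
  have hcore : angVortQuot HeredityAtOneLazySlice.lazySlice 0 = HeredityAtOneLazySlice.lvl := by
    unfold HeredityAtOneLazySlice.lazySlice
    refine SmoothedHill.angVortQuot_hillField_of_core HeredityAtOneLazySlice.rIn_pos
      HeredityAtOneLazySlice.rIn_lt_rOut ?_
    have h0 : SmoothedHill.rsq (0 : EuclideanSpace ℝ (Fin 3)) = 0 := by simp [SmoothedHill.rsq]
    rw [h0]; positivity
  rw [hcore] at h0
  norm_num [HeredityAtOneLazySlice.lvl] at h0


/-! ## §5 Every signed swirl-free readout slice of a registered stage carries POSITIVE axial impulse -/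

section PositiveImpulse

variable {ν : ℝ} {R : TowerRates} {S : Schedule R} {m : Margins R} {k : ℕ}

/-- **POSITIVE HYDRODYNAMIC IMPULSE OF A SIGNED SWIRL-FREE READOUT SLICE** (any rates, schedule, margins,
viscosity, level `k`, readout level `j ≤ k`): if the `τ_j`-slice of a registered stage is signed swirl-free then
`0 < ∫ r² (ω_θ/r)(τ_j) dx`, i.e. its impulse `I₃ = ½ ∫ r²(ω_θ/r) = ½ ∫ (x × ω)₃` (Saffman (3.2.8)) is STRICTLY
positive. Reason: the integrand is continuous and `≥ 0`; were the integral `0`, then `r²·(ω_θ/r) ≡ 0`, so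
`|ω| = r |ω_θ/r| ≡ 0` (KNSS §5), the finite-energy divergence-free slice would be the Biot–Savart velocity of `0`,
i.e. `0`, against the registered floor at `τ_j`. By Saffman (3.2.9) (`dI/dt = ∫ f dx`, not typed here) this is
exactly the axial impulse the design's force must have injected on `[0, τ_j]`.
[cite: Saffman1992, §3.2 eqs. (3.2.8), (3.2.9)] [cite: KochNadirashviliSereginSverak2009, §5 p. 9 and Remark 5.1] -/
theorem integral_cylRadius_sq_mul_angVortQuot_pos_of_signedNoSwirlSlice (s : Stage ν R S m k) {j : ℕ}
    (hj : j ≤ k) {M : ℝ} (hsl : SignedNoSwirlSlice (s.u (S.τ j)) M) :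
    0 < ∫ x, cylRadius x ^ 2 * angVortQuot (s.u (S.τ j)) x := by
  have ht : S.τ j ∈ Icc 0 (S.τ k) := τ_mem_Icc S hj
  have hv3 : ContDiff ℝ 3 (s.u (S.τ j)) := (s.contDiff_slice ht).of_le (by norm_cast)
  have hnn : ∀ x, 0 ≤ cylRadius x ^ 2 * angVortQuot (s.u (S.τ j)) x :=
    fun x => mul_nonneg (sq_nonneg _) (hsl.nonneg x)
  have hcont : Continuous fun x => cylRadius x ^ 2 * angVortQuot (s.u (S.τ j)) x :=
    (continuous_cylRadius.pow 2).mul (contDiff_angVortQuot (n := 0) (by exact_mod_cast hv3)).continuous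
  have hI0 : 0 ≤ ∫ x, cylRadius x ^ 2 * angVortQuot (s.u (S.τ j)) x := integral_nonneg fun x => hnn x
  rcases hI0.lt_or_eq with hpos | hzero
  · exact hpos
  exfalso
  have hae : (fun x => cylRadius x ^ 2 * angVortQuot (s.u (S.τ j)) x) =ᵐ[volume] 0 :=
    (integral_eq_zero_iff_of_nonneg (fun x => hnn x) hsl.integrable_sq).1 hzero.symm
  have hzero' : (fun x => cylRadius x ^ 2 * angVortQuot (s.u (S.τ j)) x) = 0 :=
    (hcont.ae_eq_iff_eq volume continuous_const).1 hae
  have hcurl : ∀ x, curl (s.u (S.τ j)) x = 0 := by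
    intro x
    have hx : cylRadius x ^ 2 * angVortQuot (s.u (S.τ j)) x = 0 := by
      simpa using congrFun hzero' x
    have hn := norm_curl_eq_cylRadius_mul_abs_angVortQuot hsl.axisym hsl.noSwirl hv3 x
    have h0 : cylRadius x * |angVortQuot (s.u (S.τ j)) x| = 0 := by
      rcases mul_eq_zero.1 hx with hr | hη
      · rw [(pow_eq_zero_iff two_ne_zero).1 hr, zero_mul]
      · rw [hη, abs_zero, mul_zero]
    rw [h0] at hn
    exact norm_eq_zero.1 hn
  have hc0 : curl (s.u (S.τ j)) = 0 := funext hcurl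
  have hBS := biotSavart_curl_eq_self_of_integrable_sq (hv3.of_le (by norm_cast)) (s.classical.divFree _ ht)
    (integrable_norm_sq_slice s ht) (by rw [hc0]; simp)
  rw [hc0, biotSavart_zero] at hBS
  exact slice_ne_zero s hj hBS.symm

end PositiveImpulse

/-- **Every member of the stratum `𝒮_k` carries positive axial impulse** `0 < ∫ r²(ω_θ/r)(τ_k)` — the number the
design's force must inject (non-zero spatial mean on `[0, τ_k]`, Saffman (3.2.9)).
[cite: Saffman1992, §3.2 eqs. (3.2.8), (3.2.9)] [cite: Palasek2026ElementaryModel, §4] -/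
theorem integral_cylRadius_sq_mul_angVortQuot_pos_of_inCapStratum {k : ℕ} {S : Schedule TowerRates.wide}
    {s : Stage 1 TowerRates.wide S (Margins.routeG TowerRates.wide) k} (hs : InCapStratum k S s) :
    0 < ∫ x, cylRadius x ^ 2 * angVortQuot (s.u (S.τ k)) x := by
  obtain ⟨M, hsl, _⟩ := hs
  exact integral_cylRadius_sq_mul_angVortQuot_pos_of_signedNoSwirlSlice s le_rfl hsl


/-! ## §6 The endpoint `t = 0`: a signed swirl-free field is never a Clay datum, so every registered
stage STARTS with zero impulse -/

/-- **No non-trivial single-signed swirl-free field has Fefferman's rapid decay (4)**: for `v ∈ C³` divergence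
free with `SignedNoSwirlSlice v M` and `HasRapidSpatialDecay v`, `ω_θ/r ≡ 0` (rapid decay ⇒ integrable ⇒ zero
impulse ⇒ `swirl_curl_eq_zero_of_nonneg`). So a signed vortex ring is never a schedule's datum `S.u₀` nor a
rapidly-decaying hand-over state: in the register it can only be CREATED BY THE FORCE (Saffman (3.2.9)).
[cite: Saffman1992, §3.2 eqs. (3.2.8), (3.2.9), (3.2.13)] -/
theorem angVortQuot_eq_zero_of_signedNoSwirlSlice_of_hasRapidSpatialDecay
    {v : EuclideanSpace ℝ (Fin 3) → EuclideanSpace ℝ (Fin 3)} {M : ℝ} (hsl : SignedNoSwirlSlice v M)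
    (hv : ContDiff ℝ 3 v) (hdiv : VectorCalculus.IsDivFree v) (hdec : HasRapidSpatialDecay v)
    (x : EuclideanSpace ℝ (Fin 3)) : angVortQuot v x = 0 :=
  angVortQuot_eq_zero_of_signedNoSwirlSlice_of_integrable hsl hv hdiv (hdec.integrable hv.continuous) x

section Datum

variable {ν : ℝ} {R : TowerRates} {S : Schedule R} {m : Margins R} {k : ℕ}

/-- **Every registered stage starts with ZERO impulse: its datum is signed swirl-free only if it vanishes.**
For any registered stage `s` (any rates, schedule, margins, viscosity, level) the datum slice `s.u 0 = S.u₀` is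
`C^∞`, divergence free, finite-energy and rapidly decaying (Fefferman (4)); if it is a signed swirl-free slice
then `s.u 0 = 0`. (The register allows the zero datum — designs generated from rest by the force — so, unlike at
the readout times `τ_j`, this is not a contradiction: it says the impulse ledger of every design opens at `I(0) = 0`.)
[cite: Saffman1992, §3.2 eqs. (3.2.8), (3.2.9)] [cite: Palasek2026ElementaryModel, §3.3] -/
theorem datum_eq_zero_of_signedNoSwirlSlice (s : Stage ν R S m k) {M : ℝ}
    (hsl : SignedNoSwirlSlice (s.u 0) M) : s.u 0 = 0 := by
  have h0 : (0 : ℝ) ∈ Icc 0 (S.τ k) := ⟨le_rfl, (S.τ_pos k).le⟩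
  have hv : ContDiff ℝ 3 (s.u 0) := (s.contDiff_slice h0).of_le (by norm_cast)
  exact signedNoSwirlSlice_eq_zero_of_integrable hsl hv (s.classical.divFree _ h0)
    (s.hasRapidSpatialDecay_zero.integrable (s.contDiff_slice h0).continuous) (integrable_norm_sq_slice s h0)

/-- **The datum of every registered stage has zero velocity flux**, `∫ S.u₀ dx = 0` (Clay datum: `C¹`,
divergence free, rapidly decaying ⇒ integrable; Saffman (3.2.15)) — the `t = 0` entry of the impulse ledger.
[cite: Saffman1992, §3.2 eq. (3.2.15)] -/
theorem integral_datum_eq_zero (s : Stage ν R S m k) : ∫ x, s.u 0 x = 0 := by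
  have h0 : (0 : ℝ) ∈ Icc 0 (S.τ k) := ⟨le_rfl, (S.τ_pos k).le⟩
  have hv : ContDiff ℝ 1 (s.u 0) := (s.contDiff_slice h0).of_le (by norm_cast)
  exact integral_eq_zero_of_isDivFree_of_integrable hv (s.classical.divFree _ h0)
    (s.hasRapidSpatialDecay_zero.integrable hv.continuous)

end Datum

end Summit.NavierStokesRegularity.HeredityAtOneImpulse

end
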